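import Summits.BirchSwinnertonDyer.BirchSwinnertonDyer.Theorems.PrintX9HeegnerDivisibility
import HarnessLib

/-!
# Route `PrintX9`, item 20531 (`Assembly`, rev 1): `HeegnerDivisibilityX9 → MuTransfer →
# AnalyticMuZeroX9 → HeegnerPrintFactsX9 → CyclotomicPrintFactsX9 → Rank1Residual.BSDpOnClassX9`, PROVED
# (cell `bsd-print-x9`, unit `bsd-print-x9-p4`)

HONEST FRAMING (cell `bsd-print-x9`, HOME `run/shared/lean/pub/bsd-print-x9/`): the route's `Assembly`
(rev 1, planner g1, 2026-08-27) is a CONDITIONAL — the X9 LEAF `Rank1Residual.BSDpOnClassX9` (rung K6: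
`BSD_p` at every X9 pair of analytic rank `≤ 1` with `Ш` finite — non-CM, good ordinary `p ≥ 5`, `E[p]`
irreducible, `ρ̄_{E,p}` NOT onto) from the route's three OPEN items J (`HeegnerDivisibilityX9`, 20392:
derived Heegner points `p^s`-divisible to Tamagawa depth over Heegner fields), `MuTransfer` (19629 = K6's
`KatoMuTransfer`, kernel-checked modulo Kato's package F1) and `AnalyticMuZeroX9` (19630 = K6's
`AnalyticMuZeroOnClassX9`), and its two PUBLISHED cite-only bundles `HeegnerPrintFactsX9` (20530, twelve
Heegner-side facts) and `CyclotomicPrintFactsX9` (20532, six cyclotomic/modularity facts). It is proved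
here by the one-line port onto the landed Schneider-free kernel
`Rank1Residual.bsdpOnClassX9_of_heegnerDivisibilityX9_of_katoMuTransfer`
(`Theorems/PrintX9HeegnerDivisibility.lean`, p537990): rank-`1` members — STEP L (BCS 2025 Thm. 1.2.4 (a)
+ Prop. 4.2.2 ∘ CGLS 2022 Thm. 5.1.3 + JSW 2017 Thm. 3.3.1) and J + Cha 2005 Rmk. 25 give the Heegner
index identity over a Hoffstein–Luo field `K` at every Tamagawa depth, then the JSW §7.4 descent with
the twist's rank-`0` `p`-part from `MuTransfer ∧ AnalyticMuZeroX9` (⟹ `IntegralMainConjectureOnClassX9`,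
class X9 being twist-closed); rank-`0` members — that engine directly. Nothing is booked; no named fact
is introduced; J, MuTransfer, AnalyticMuZeroX9 stay OPEN items.

References: [Cha2005] Thm. 21, Rmk. 25; [MatarNekovar2019] Prop. 5.26 (2); [BurungaleCastellaSkinner2025]
Thm. 1.1.2 (a), Thm. 1.2.4 (a), Prop. 4.2.2, Cor. 1.3.1; [JetchevSkinnerWan2017] Thm. 3.3.1, §7.4;
[Kato2004Asterisque] Thm. 12.5, 17.4; [GrossZagier1986] I (6.5), V §2; [Miller2011LMS] Def. 1.1.
-/

set_option autoImplicit false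
set_option linter.dupNamespace false

noncomputable section

namespace Summit.BirchSwinnertonDyer.BirchSwinnertonDyer.Rank1Residual

/-- **Route `PrintX9`, item 20531 (`Assembly`, rev 1), PROVED**: `HeegnerDivisibilityX9 → MuTransfer →
AnalyticMuZeroX9 → HeegnerPrintFactsX9 → CyclotomicPrintFactsX9 → Rank1Residual.BSDpOnClassX9` — the
two bundles destructured in their binder order and handed, with the three items, to the landed kernel
`bsdpOnClassX9_of_heegnerDivisibilityX9_of_katoMuTransfer` (p537990). CONDITIONAL on the route's open
items (they are its hypotheses); nothing booked. [cite: BurungaleCastellaSkinner2025, Cor. 1.3.1 and its proof (p. 4)]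
[cite: Cha2005, Rmk. 25 (p. 175)] [cite: JetchevSkinnerWan2017, Thm. 3.3.1 and §7.4.1 (pp. 30–31)]
[cite: Miller2011LMS, §1 and Def. 1.1] -/
theorem assembly_proof : Summit.BirchSwinnertonDyer.BirchSwinnertonDyer.Theses.PrintX9.Assembly := by
  unfold Summit.BirchSwinnertonDyer.BirchSwinnertonDyer.Theses.PrintX9.Assembly
  intro hJ h1 h2 hHP hCP
  obtain ⟨hGZ, hKo, hrec, hD36, hChaU, h526, h124a, h331, hnf, hHL, hMaz, hNS⟩ := hHP
  obtain ⟨hBCS, hGr, hGZK, hmod, hpar, h5⟩ := hCP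
  exact bsdpOnClassX9_of_heegnerDivisibilityX9_of_katoMuTransfer hGZ hKo hrec hD36 hChaU h526 h124a h331
    hBCS hGr hGZK hmod hpar hnf hHL hMaz hNS h5 hJ h1 h2

end Summit.BirchSwinnertonDyer.BirchSwinnertonDyer.Rank1Residual

end
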